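import Literature.MathematicalPhysics.QuantumFieldTheory.Balaban1983to89.B7Prop2Explicit
import Literature.MathematicalPhysics.QuantumFieldTheory.Balaban1983to89.T4TermwiseTorus
import Literature.MathematicalPhysics.QuantumFieldTheory.Balaban1983to89.UnitaryModel

/-!
# Spine/NE7/QLaTorusDictionary — the dictionary between Setup's tori `T^{(j)}` (sites `Fin d → ZMod T_j`, CENTRED coarse
# embedding `emb`, blocks `blockOf`) and the B7 fold's `ℤ^d` (corner blocks `L·z + [0,L)^d`): periodic lifts of `U(N)`-valued
# gauge fields and gauge transformations, `T_j = T_{j+1}·L`, `[cen x]_{T_j} = emb [x]_{T_{j+1}}`, `blockOf [x] = [z]` on `B(z)`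

Cell `pub-balaban-gaps` (YM blitz Y1, track G2, seat `ne7`, generation 6); text of record
`run/shared/lean/pub/pub-balaban-gaps/ne/NE7.md` v6 §4septies, census row R39 half (b) («dictionary», DIVERGENCES F3∕F6 of the
`pub-balaban` cell) — obligations (O1)–(O2) of the scoping note `pub-balaban-gaps-ne7/g5/HALF-B-SCOPE.md`.  Seventeenth
`Spine/NE7/` file; consumed by `Spine/NE7/QLaTorusB7Averaging` (the `Setup.Averaging` instance realising
[Balaban1985Averaging] (15)∕(42) on the torus) and by the `FramedBondLip` instance built on it.

WHAT IS HERE (bookkeeping only, no analysis).  §1: a level-`j` torus gauge field `U : PBond P j → U(N)`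
(`Matrix.unitaryGroup (Fin N) ℂ`, the tree's `UnitaryModel` gauge-group model, `dist1 = ‖· − 1‖_{op}`) is read on the
universal cover as the `T_j`-periodic configuration `liftCfg U : ℤ^d → Fin d → M_N(ℂ)ˣ` of the B7 fold (`B7Prop1Explicit`:
`Site d = Fin d → ℤ`, values in units), `Ũ(x, κ) = U(⟨[x]_{T_j}, κ⟩)` (`T4TermwiseTorus.tcls`); likewise gauge transformations;
the lift is periodic (`liftCfg_periodic`), `U(N)`-valued (`liftCfg_mem`, the B7 fold's `unitaryUnits`), intertwines the
gauge actions (8) of both sides (`liftCfg_gaugeAct`) and sends `1` to `1`.  §2: in the standing range `j + 1 ≤ m + K` the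
periods satisfy `T_j = T_{j+1}·L` (`per_succ`); the CENTRE `cen z = L·z + h·𝟙`, `h = (L−1)/2`, of the corner block
`B(z) = L·z + [0,L)^d` reduces on the torus to Setup's embedded coarse site, `[cen x]_{T_j} = emb [x]_{T_{j+1}}` (`tcls_cen`
— B12 p. 251 «the coarse sites are the centres `y` of the cubes `Δ(y)`», Setup's `emb`), and every fine point of `B(z)` has
Setup-block `[z]` (`blockOf_tcls` — Setup's `blockOf` = integer division of the `val` representatives by `L`, i.e. CORNER
blocks in representatives, DIVERGENCE F3 of the `pub-balaban` cell); `w0` is the fixed tree word from the centre of a block to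
its corner (`cen_add_disp_w0`).

HONEST FRAMING.  [folklore] modular arithmetic on `ℤ^d` ∕ `(ℤ/T)^d`; nothing of Bałaban's is asserted; (QL-a) NOT IN PRINT;
NE7 NOT proved; spine 0∕9; fixed finite T⁴ — NOT ℝ⁴, NOT infinite volume, NOT a mass gap, NOT Clay.
-/

noncomputable section

open scoped BigOperators Matrix.Norms.L2Operator

namespace Summit.QuantumFields.BalabanUV.T4Continuum.Spine.NE7.TorusB7

open Literature.MathematicalPhysics.QuantumFieldTheory.Balaban1983to89
open Literature.MathematicalPhysics.QuantumFieldTheory.Balaban1983to89.B7Prop1Explicit hiding Site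
open Literature.MathematicalPhysics.QuantumFieldTheory.Balaban1983to89.B7Prop2Explicit (unitaryUnits)
open Literature.MathematicalPhysics.QuantumFieldTheory.Balaban1983to89.T4TermwiseTorus (tcls tcls_apply tcls_add tlift
  tcls_tlift IsPeriodic)

/-- The ambient matrix algebra `M_N(ℂ)` (operator norm (19) = Mathlib's `L²`-operator norm, scope `Matrix.Norms.L2Operator`, as
everywhere in the cell; DIVERGENCE F11). [cite: Balaban1985Averaging, (19) p.21] -/
abbrev Mat (N : ℕ) : Type := Matrix (Fin N) (Fin N) ℂ

variable {P : Params} {N : ℕ}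

/-! ## §1 The dictionary torus ↔ `ℤ^d`: periodic lifts of gauge fields and gauge transformations -/

/-- The period of the level-`j` torus in every direction: `T_j = 2L^{m+K−j}` sites (Setup's `sitesPerDir`, B12 (0.1)). [cite: Balaban1987RG1, (0.1) p.251] -/
abbrev per (P : Params) (j : ℕ) : ℕ := P.sitesPerDir j

/-- LIFT of a level-`j` torus gauge field with values in `U(N)` to a (`T_j`-periodic) configuration on `ℤ^d` with values in
the units of `M_N(ℂ)`: `Ũ(x, κ) = U(⟨[x], κ⟩)` (a field on the torus of B12 (0.1) read on the universal cover, as in `T4TermwiseTorus`). [cite: Balaban1987RG1, (0.1) p.251] -/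
def liftCfg {j : ℕ} (U : GaugeField P j (Matrix.unitaryGroup (Fin N) ℂ)) : (Fin P.d → ℤ) → Fin P.d → (Mat N)ˣ :=
  fun x κ => Unitary.toUnits (U ⟨tcls (per P j) x, κ⟩)

/-- LIFT of a level-`j` torus gauge transformation: `ũ(x) = u([x])`. [cite: Balaban1987RG1, (0.1) p.251] -/
def liftTransf {j : ℕ} (u : GaugeTransf P j (Matrix.unitaryGroup (Fin N) ℂ)) : (Fin P.d → ℤ) → (Mat N)ˣ :=
  fun x => Unitary.toUnits (u (tcls (per P j) x))

/-- Unfolding: the matrix of `Ũ(x, κ)` is the matrix of `U(⟨[x], κ⟩)`. [folklore] -/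
@[simp] theorem val_liftCfg {j : ℕ} (U : GaugeField P j (Matrix.unitaryGroup (Fin N) ℂ)) (x : Fin P.d → ℤ) (κ : Fin P.d) :
    ((liftCfg U x κ : (Mat N)ˣ) : Mat N) = (U ⟨tcls (per P j) x, κ⟩ : Mat N) := rfl

/-- Unfolding: the matrix of `ũ(x)` is the matrix of `u([x])`. [folklore] -/
@[simp] theorem val_liftTransf {j : ℕ} (u : GaugeTransf P j (Matrix.unitaryGroup (Fin N) ℂ)) (x : Fin P.d → ℤ) :
    ((liftTransf u x : (Mat N)ˣ) : Mat N) = (u (tcls (per P j) x) : Mat N) := rfl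

/-- Unfolding: the matrix of `ũ(x)⁻¹` is the matrix of `u([x])⁻¹`. [folklore] -/
@[simp] theorem val_inv_liftTransf {j : ℕ} (u : GaugeTransf P j (Matrix.unitaryGroup (Fin N) ℂ)) (x : Fin P.d → ℤ) :
    (((liftTransf u x)⁻¹ : (Mat N)ˣ) : Mat N) = ((u (tcls (per P j) x))⁻¹ : Matrix.unitaryGroup (Fin N) ℂ) := by
  rw [liftTransf, ← map_inv]; rfl

/-- The lift is `U(N)`-valued (the B7 fold's `unitaryUnits`). [folklore] -/
theorem liftCfg_mem {j : ℕ} (U : GaugeField P j (Matrix.unitaryGroup (Fin N) ℂ)) (x : Fin P.d → ℤ) (κ : Fin P.d) :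
    liftCfg U x κ ∈ unitaryUnits (Mat N) := (U ⟨tcls (per P j) x, κ⟩).2

/-- The lifted gauge transformation is `U(N)`-valued. [folklore] -/
theorem liftTransf_mem {j : ℕ} (u : GaugeTransf P j (Matrix.unitaryGroup (Fin N) ℂ)) (x : Fin P.d → ℤ) :
    liftTransf u x ∈ unitaryUnits (Mat N) := (u (tcls (per P j) x)).2

/-- One lattice step on `ℤ^d` descends to `Site.shift` on the torus. [folklore] -/
theorem tcls_add_e (j : ℕ) (x : Fin P.d → ℤ) (κ : Fin P.d) :
    (tcls (per P j) (x + e κ) : Site P j) = Site.shift (tcls (per P j) x : Site P j) κ := by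
  funext μ
  by_cases h : μ = κ
  · subst h; simp [Site.shift, e_apply]
  · simp [Site.shift, e_apply, h]

/-- The lift is `T_j`-periodic. [folklore] -/
theorem liftCfg_periodic {j : ℕ} (U : GaugeField P j (Matrix.unitaryGroup (Fin N) ℂ)) : IsPeriodic (per P j) (liftCfg U) := by
  intro x m
  funext κ
  simp only [liftCfg, tcls_add, T4TermwiseTorus.tcls_period, add_zero]

section GaugeActs

variable [NeZero N]

/-- The lift intertwines the gauge actions (8) of the torus (`Setup.GaugeField.gaugeAct`) and of `ℤ^d` (`B7Prop1Explicit.gaugeAct`): `(U^u)~ = Ũ^{ũ}`. [cite: Balaban1985Averaging, (8) p.18] -/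
theorem liftCfg_gaugeAct {j : ℕ} (u : GaugeTransf P j (Matrix.unitaryGroup (Fin N) ℂ))
    (U : GaugeField P j (Matrix.unitaryGroup (Fin N) ℂ)) :
    liftCfg (GaugeField.gaugeAct u U) = gaugeAct (liftTransf u) (liftCfg U) := by
  funext x κ
  simp only [liftCfg, liftTransf, gaugeAct, GaugeField.gaugeAct, map_mul, map_inv, PBond.tgt, tcls_add_e]

/-- The lift of the trivial configuration is trivial. [folklore] -/
@[simp] theorem liftCfg_one {j : ℕ} : liftCfg (1 : GaugeField P j (Matrix.unitaryGroup (Fin N) ℂ)) = 1 := by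
  funext x κ
  exact map_one _

end GaugeActs

/-! ## §2 Block arithmetic: periods, centres, blocks -/

/-- In the standing range `j + 1 ≤ m + K` the fine period is `L` times the coarse one: `T_j = T_{j+1}·L`. [cite: Balaban1987RG1, (0.1) p.251] -/
theorem per_succ {j : ℕ} (hj : j + 1 ≤ P.m + P.K) : per P j = per P (j + 1) * P.L := by
  simp only [per, Params.sitesPerDir]
  have : P.m + P.K - j = (P.m + P.K - (j + 1)) + 1 := by omega
  rw [this, pow_succ]; ring

/-- Half the block side: `h = (L − 1)/2` (`L` odd, B12 p. 251). [cite: Balaban1987RG1, (0.1) p.251] -/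
def hb (P : Params) : ℕ := (P.L - 1) / 2

/-- `h ≤ L − 1`. [folklore] -/
theorem hb_le (P : Params) : (hb P : ℤ) ≤ (P.L : ℤ) - 1 := by
  have := P.hL.2
  have h : hb P ≤ P.L - 1 := Nat.div_le_self _ _
  unfold hb at *
  omega

/-- The CENTRE of the block with corner `L·z` in fine coordinates: `L·z + h·𝟙` (B12 p. 251: the coarse sites are the centres of the cubes; Setup's `emb`, DIVERGENCE F3). [cite: Balaban1987RG1, (0.1) p.252] -/
def cen (P : Params) (z : Fin P.d → ℤ) : Fin P.d → ℤ := fun i => (P.L : ℤ) * z i + (hb P : ℤ)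

/-- The fixed tree word (B5 (1.7) ∕ B7 p. 24 broken line) from the centre of a block to its corner (displacement `−h·𝟙`). [cite: Balaban1985Averaging, p.24] -/
def w0 (P : Params) : List (Letter P.d) := treeWord (fun _ : Fin P.d => -(hb P : ℤ))

/-- The word `w0` leads from the centre `cen z` to the corner `L·z`. [folklore] -/
theorem cen_add_disp_w0 (z : Fin P.d → ℤ) : cen P z + disp (w0 P) = (P.L : ℤ) • z := by
  funext i; simp [cen, w0]

/-- Centres are `L`-equivariant: `cen (z + w) = cen z + L·w`. [folklore] -/
theorem cen_add (z w : Fin P.d → ℤ) : cen P (z + w) = cen P z + (P.L : ℤ) • w := by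
  funext i; simp [cen]; ring

/-- The centre of block `[x]` is Setup's embedded coarse site: `[cen x]_{T_j} = emb [x]_{T_{j+1}}` (B12 p. 251–252: label `n ↦ nL + (L−1)/2`). [cite: Balaban1987RG1, (0.1) p.252] -/
theorem tcls_cen {j : ℕ} (hj : j + 1 ≤ P.m + P.K) (x : Fin P.d → ℤ) :
    (tcls (per P j) (cen P x) : Site P j) = emb (tcls (per P (j + 1)) x : Site P (j + 1)) := by
  funext μ
  simp only [tcls_apply, cen, emb]
  rw [← Int.cast_natCast (R := ZMod (per P j)), ZMod.intCast_eq_intCast_iff_dvd_sub]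
  push_cast
  rw [ZMod.val_intCast, per_succ hj]
  have hT : ((per P (j + 1) : ℕ) : ℤ) ∣ x μ % (per P (j + 1) : ℕ) - x μ := by
    rw [Int.emod_def]; exact ⟨-(x μ / (per P (j + 1) : ℕ)), by ring⟩
  obtain ⟨c, hc⟩ := hT
  refine ⟨c, ?_⟩
  have hh : (hb P : ℤ) = (((P.L - 1) / 2 : ℕ) : ℤ) := rfl
  rw [hh]
  push_cast
  linear_combination (P.L : ℤ) * hc

/-- BLOCKS: a fine point `x` of the corner block `[L·z, L·z + (L−1)·𝟙]` has Setup-block `[z]` on the torus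
(Setup's `blockOf` is integer division by `L` of the `val` representatives — corner blocks, DIVERGENCE F3; B12 (0.3) `B(y) = Δ(y) ∩ T`). [cite: Balaban1987RG1, (0.1) p.252] -/
theorem blockOf_tcls {j : ℕ} (hj : j + 1 ≤ P.m + P.K) (z x : Fin P.d → ℤ)
    (hx : ∀ i, (P.L : ℤ) * z i ≤ x i ∧ x i ≤ (P.L : ℤ) * z i + ((P.L : ℤ) - 1)) :
    blockOf (tcls (per P j) x : Site P j) = (tcls (per P (j + 1)) z : Site P (j + 1)) := by
  have hL : 0 < P.L := P.L_pos
  funext μ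
  simp only [blockOf, tcls_apply]
  set T' : ℕ := per P (j + 1) with hT'
  have hT'0 : (T' : ℤ) ≠ 0 := by exact_mod_cast (P.sitesPerDir_ne_zero (j + 1))
  set r : ℤ := x μ - (P.L : ℤ) * z μ with hr
  have hr0 : 0 ≤ r := by have := (hx μ).1; omega
  have hrL : r < P.L := by have := (hx μ).2; omega
  -- the `val` representative of `x μ` modulo `T_j = T'·L`
  have hv : (((x μ : ZMod (per P j))).val : ℤ) = r + (P.L : ℤ) * (z μ % T') := by
    rw [ZMod.val_intCast, per_succ hj, Nat.cast_mul]
    have hz : x μ = r + (P.L : ℤ) * (z μ % T') + (T' * P.L : ℤ) * (z μ / T') := by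
      have := Int.emod_def (z μ) T'
      rw [hr, this]; ring
    rw [hz, Int.add_mul_emod_self_left]
    have h1 : 0 ≤ z μ % T' := Int.emod_nonneg _ hT'0
    have h2 : z μ % T' < T' := Int.emod_lt_of_pos _ (by positivity)
    exact Int.emod_eq_of_lt (by positivity) (by nlinarith)
  have hdiv : (((x μ : ZMod (per P j)).val / P.L : ℕ) : ℤ) = z μ % T' := by
    rw [Int.natCast_div, hv, Int.add_mul_ediv_left _ _ (by exact_mod_cast hL.ne'), Int.ediv_eq_zero_of_lt hr0 hrL,
      zero_add]
  rw [← Int.cast_natCast (R := ZMod T'), hdiv, ZMod.intCast_mod]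

/-- The centre of a block lies in the block. [folklore] -/
theorem cen_mem_block (z : Fin P.d → ℤ) (i : Fin P.d) :
    (P.L : ℤ) * z i ≤ cen P z i ∧ cen P z i ≤ (P.L : ℤ) * z i + ((P.L : ℤ) - 1) := by
  have := hb_le P
  simp only [cen]
  constructor <;> omega

end Summit.QuantumFields.BalabanUV.T4Continuum.Spine.NE7.TorusB7

end
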